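import Mathlib
import Summits.Ventures.LatticeQCDFlow.TrivializingMaps.AcceptanceFootprintFloor
import HarnessLib

/-!
# No acceptance-only footprint law beats the curve `4 acc (1 - acc)` (row 96f)

Honest framing: exact (Metropolis-corrected) sampling algorithms for lattice gauge theory; figures
of merit are autocorrelation/cost numbers at stated couplings and volumes; no continuum-physics
claim.

Venture `LatticeQCDFlow` (cell pub-lqcd), topic `TrivializingMaps`; FANOUT row 28 (theory-1),
THEORY-1 §36.  NEW WORK of the cell; nothing is cited as a fact.  This file is the LOWER half of the
statement "the sharp acceptance–footprint function is EXACTLY `g♯(acc) = 1 - ((2 acc - 1)₊)²`":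

* `Sharp.curve_le_of_law` — if an acceptance-only law `|Cov_π(A, B)| ≤ g(acc) · a b` holds for all
  targets, models and witnesses satisfying the hypotheses of THEOREM Q
  (`AcceptanceFootprint.abs_cov_le_of_meanAccept`) — already on two links with two states each — then
  `4 acc (1 - acc) ≤ g(acc)` for EVERY `acc ∈ [0, 1]` (the corner family of `AcceptanceFootprintFloor`
  has acceptance exactly `acc` and covariance exactly `4 acc (1 - acc)`);
* `Sharp.envelope_le_of_law` — together with the tree's `Sharp.one_le_of_law`: such a `g` satisfies
  `g(acc) ≥ 1` on `[0, ½]` and `g(acc) ≥ 4 acc (1 - acc)` on `[½, 1]`, i.e. `g ≥ 1 - ((2 acc - 1)₊)²`.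

The matching UPPER half — the law DOES hold with `g(acc) = 4 acc (1 - acc)` for `acc ≥ ½`, in every
setting of THEOREM Q (any reference measure), in range form and for `SU(n)` lattice gauge theory — is
`AcceptanceCurveFullMeasure.abs_cov_le_curve_of_meanAccept` (row 96e); with `|A| ≤ a`, `|B| ≤ b` the
bound `a b` on `[0, ½]` is elementary.  NOT CLAIMED here: anything beyond the two-link examples; cost,
autocorrelation, continuum.  No `sorry`, no new axioms, no `def`.
-/

namespace Summit.Ventures.LatticeQCDFlow.TrivializingMaps

open MeasureTheory Set
open scoped ENNReal NNReal

namespace Sharp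

/-- **NO ACCEPTANCE-ONLY LAW BEATS THE CURVE.**  If `|Cov_π(A, B)| ≤ g(acc) · a b` holds for all
targets, models and witnesses satisfying the hypotheses of `abs_cov_le_of_meanAccept` on two links with
two states each (counting reference measure), then `4 acc (1 - acc) ≤ g acc` for every `acc ∈ [0, 1]`:
the corner family with `λ = 1 - acc` has equilibrium acceptance exactly `acc` and
`Cov_π(σ₁, σ₂) = 4 acc (1 - acc)` with `a = b = 1`. -/
theorem curve_le_of_law (g : ℝ → ℝ)
    (hlaw : ∀ (p q A B : Bool × Bool → ℝ) (a b acc : ℝ), (∀ z, 0 ≤ p z) → Measurable p →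
      Integrable p (Measure.count : Measure (Bool × Bool)) →
      ∫ z, p z ∂(Measure.count : Measure (Bool × Bool)) = 1 → (∀ z, 0 ≤ q z) → Measurable q →
      Integrable q (Measure.count : Measure (Bool × Bool)) →
      ∫ z, q z ∂(Measure.count : Measure (Bool × Bool)) = 1 →
      acc ≤ ∫ x, ∫ y, min (p x * q y) (p y * q x) ∂(Measure.count : Measure (Bool × Bool))
        ∂(Measure.count : Measure (Bool × Bool)) →
      Measurable A → Measurable B → (∀ z, |A z| ≤ a) → (∀ z, |B z| ≤ b) →
      ∫ z, A z * B z ∂((Measure.count : Measure (Bool × Bool)).withDensity fun z => ENNReal.ofReal (q z))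
        = (∫ z, A z ∂((Measure.count : Measure (Bool × Bool)).withDensity fun z => ENNReal.ofReal (q z)))
          * ∫ z, B z ∂((Measure.count : Measure (Bool × Bool)).withDensity fun z => ENNReal.ofReal (q z)) →
      |∫ z, A z * B z ∂((Measure.count : Measure (Bool × Bool)).withDensity fun z => ENNReal.ofReal (p z))
        - (∫ z, A z ∂((Measure.count : Measure (Bool × Bool)).withDensity fun z => ENNReal.ofReal (p z)))
          * ∫ z, B z ∂((Measure.count : Measure (Bool × Bool)).withDensity fun z => ENNReal.ofReal (p z))|
        ≤ g acc * (a * b))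
    {acc : ℝ} (h0 : 0 ≤ acc) (h1 : acc ≤ 1) : 4 * acc * (1 - acc) ≤ g acc := by
  obtain ⟨hp0, hpm, hpi, hp1, hq0, hqm, hqi, hq1, hAm, hBm, hA1, hB1, hfac, hmean, hcov⟩ :=
    corner_family (lam := 1 - acc) (by linarith) (by linarith)
      (p := fun z => if z.1 = z.2 then (if z.1 = true then 1 - (1 - acc) else 1 - acc) else 0)
      (q := fun z => if z = (true, true) then 1 else 0)
      (A := fun z => if z.1 = true then 1 else -1) (B := fun z => if z.2 = true then 1 else -1)
      (fun _ => rfl) (fun _ => rfl) (fun _ => rfl) (fun _ => rfl)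
  have hacc : acc ≤ ∫ x, ∫ y, min ((fun z : Bool × Bool => if z.1 = z.2 then
        (if z.1 = true then 1 - (1 - acc) else 1 - acc) else (0:ℝ)) x
          * (fun z : Bool × Bool => if z = (true, true) then (1:ℝ) else 0) y)
        ((fun z : Bool × Bool => if z.1 = z.2 then (if z.1 = true then 1 - (1 - acc) else 1 - acc)
          else (0:ℝ)) y * (fun z : Bool × Bool => if z = (true, true) then (1:ℝ) else 0) x)
        ∂(Measure.count : Measure (Bool × Bool)) ∂(Measure.count : Measure (Bool × Bool)) := by
    rw [hmean]; linarith
  have h := hlaw _ _ _ _ 1 1 acc hp0 hpm hpi hp1 hq0 hqm hqi hq1 hacc hAm hBm hA1 hB1 hfac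
  have habs : |4 * (1 - acc) * (1 - (1 - acc))| = 4 * acc * (1 - acc) := by
    rw [abs_of_nonneg (by nlinarith)]; ring
  rw [hcov, habs] at h
  simpa using h

/-- **THE SHARP FOOTPRINT FUNCTION FROM BELOW.**  Every acceptance-only law `g` as above satisfies
`g(acc) ≥ 1` for `acc ≤ ½` (`one_le_of_law`, the floor family) and `g(acc) ≥ 4 acc (1 - acc)` for
`½ ≤ acc ≤ 1` (`curve_le_of_law`), i.e. `g(acc) ≥ 1 - ((2 acc - 1)₊)²` on `[0, 1]` — written without
the positive part: `min 1 (4 acc (1 - acc))` for `acc ≥ ½` and `1` below.  With row 96e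
(`abs_cov_le_curve_of_meanAccept`: the law holds with `4 acc (1 - acc)` for `acc ≥ ½` in every setting)
this envelope IS the sharp footprint function. -/
theorem envelope_le_of_law (g : ℝ → ℝ)
    (hlaw : ∀ (p q A B : Bool × Bool → ℝ) (a b acc : ℝ), (∀ z, 0 ≤ p z) → Measurable p →
      Integrable p (Measure.count : Measure (Bool × Bool)) →
      ∫ z, p z ∂(Measure.count : Measure (Bool × Bool)) = 1 → (∀ z, 0 ≤ q z) → Measurable q →
      Integrable q (Measure.count : Measure (Bool × Bool)) →
      ∫ z, q z ∂(Measure.count : Measure (Bool × Bool)) = 1 →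
      acc ≤ ∫ x, ∫ y, min (p x * q y) (p y * q x) ∂(Measure.count : Measure (Bool × Bool))
        ∂(Measure.count : Measure (Bool × Bool)) →
      Measurable A → Measurable B → (∀ z, |A z| ≤ a) → (∀ z, |B z| ≤ b) →
      ∫ z, A z * B z ∂((Measure.count : Measure (Bool × Bool)).withDensity fun z => ENNReal.ofReal (q z))
        = (∫ z, A z ∂((Measure.count : Measure (Bool × Bool)).withDensity fun z => ENNReal.ofReal (q z)))
          * ∫ z, B z ∂((Measure.count : Measure (Bool × Bool)).withDensity fun z => ENNReal.ofReal (q z)) →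
      |∫ z, A z * B z ∂((Measure.count : Measure (Bool × Bool)).withDensity fun z => ENNReal.ofReal (p z))
        - (∫ z, A z ∂((Measure.count : Measure (Bool × Bool)).withDensity fun z => ENNReal.ofReal (p z)))
          * ∫ z, B z ∂((Measure.count : Measure (Bool × Bool)).withDensity fun z => ENNReal.ofReal (p z))|
        ≤ g acc * (a * b))
    {acc : ℝ} (h0 : 0 ≤ acc) (h1 : acc ≤ 1) :
    (if acc ≤ 1 / 2 then (1 : ℝ) else 4 * acc * (1 - acc)) ≤ g acc := by
  split_ifs with hhalf
  · exact one_le_of_law g hlaw hhalf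
  · exact curve_le_of_law g hlaw h0 h1

end Sharp

end Summit.Ventures.LatticeQCDFlow.TrivializingMaps
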